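import Mathlib
import HarnessLib
import Literature.MathematicalPhysics.QuantumFieldTheory.ConstructiveQFTWave0
import Literature.MathematicalPhysics.QuantumFieldTheory.FlatLatticeGaugeFields
import Summits.Ventures.LatticeQCDFlow.Scaling.ThinSectorsConnected

/-!
# Cochains on the discrete `d`-torus: line sums, partial sums and the degree-one Poincaré lemma

HONEST FRAMING: exact (Metropolis-corrected) sampling algorithms for lattice gauge theory;
figures of merit are autocorrelation/cost numbers at stated couplings and volumes; no
continuum-physics claim.

Venture `LatticeQCDFlow` (cell pub-lqcd), topic `Scaling`, FANOUT row 29 (theory2, gen-23), item 112a.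
NEW WORK over Mathlib and the tree's lattice vocabulary `Site d L = Fin d → ZMod L`, `Edge`,
`Site.shift` (`Literature/…/ConstructiveQFTWave0`); it imports `Scaling/ThinSectorsConnected` (item
110) only for its three `ZMod`-sum lemmas.  Nothing here is cited as a fact; everything is elementary
cellular cohomology of the cubical torus written out for Lean.  LITERATURE STATUS (honest): that the
integer cohomology of the `d`-torus is torsion-free with `H¹` generated by the coordinate circles (so
a closed `1`-cochain with vanishing circle sums is exact over `ℤ`, not only over `ℝ`) is textbook
algebraic topology; its lattice-gauge use (Dirac strings of compact `U(1)`) is DeGrand–Toussaint and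
Lüscher [Luscher1999AbelianChiral, §7].  Grade: formalisation of known mathematics, no new theorem.

PURPOSE.  First of two pure-algebra files (`TorusCochain`, `TorusPoincareLemma`) behind the
every-dimension sector theorem `Scaling/MonopoleSectors` (conjecture C10 of the cell's THEORY-2 §4):
there one needs that an INTEGER `2`-cochain on `(ℤ/L)^d` which is antisymmetric, closed (zero cube
coboundary) and has zero periods through the coordinate `2`-tori is the curl of an integer
`1`-cochain.  Item 110 proved `d = 2` (`ThinSectors.exists_curl_eq`: a function with zero total); the
general case is `TorusPoincareLemma.exists_curl_eq`, by killing one coordinate direction at a time,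
and the degree-one lemma of the present file is the tool that kills a direction.

CONTENTS (coefficients in an arbitrary additive commutative group `A`; `L ≥ 1`; any `d`).
§1 coordinates: `Site.shift` versus `Function.update` bookkeeping; `eq_of_forall_shift` (a
shift-invariant function on the torus is constant).  §2 `lineSum κ f x = Σ_t f(x|_{κ := t})` (the sum
over the `κ`-circle through `x`), the partial sum `pSum κ f x = Σ_{i < x_κ} f(x|_{κ := i})` with the
telescoping identities `pSum_shift_self_sub` (a primitive along the line, up to the circle sum dumped
on the last link) and `pSum_shift_sub`, and `lineSum_eq_sum_add_single` (the `x + t κ̂`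
parametrisation).  §3 DEGREE ONE, `exists_grad_eq`: a closed `1`-cochain (`Δ_ν W_ρ = Δ_ρ W_ν`) all
of whose circle sums vanish is a gradient `W = grad φ`, `φ : Site → A`; proof: `kill_one` (subtract
the gradient of the `κ`-partial-sum primitive: the `κ`-component dies and dead components stay dead)
iterated over the directions (`exists_grad_eq_aux`, induction on a cut-off, not on the dimension).

No `sorry`, no new axioms, no `opaque`; standard axioms only.
-/

noncomputable section

namespace Summit.Ventures.LatticeQCDFlow.Theory2.Lattice.Flux.TorusCochain

open Finset
open Literature.MathematicalPhysics.QuantumFieldTheory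
open Summit.Ventures.LatticeQCDFlow.Theory2.Lattice.Flux.ThinSectors (sum_zmod_val_eq sum_range_cast_eq
  val_add_one_eq_mod)

variable {d L : ℕ} {A : Type*} [AddCommGroup A]


/-! ## §1. Coordinates: shifts versus coordinate updates -/

/-- `(x + ê_κ)_κ = x_κ + 1`. [folklore] -/
theorem shift_apply_self (x : Site d L) (κ : Fin d) : x.shift κ κ = x κ + 1 := by
  simp [Site.shift]

/-- `(x + ê_κ)_j = x_j` for `j ≠ κ`. [folklore] -/
theorem shift_apply_of_ne (x : Site d L) {κ j : Fin d} (h : j ≠ κ) : x.shift κ j = x j := by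
  simp [Site.shift, h]

-- LANDING NOTE (lean-1 GEN-7, custody of theory2 LANDING.md §27, item 112a): theory2's
-- `shift_comm` ((x + ê_μ) + ê_ν = (x + ê_ν) + ê_μ) is deleted here: the gate's `dedup.landed`
-- identified it with the tree's
-- `Literature.MathematicalPhysics.QuantumFieldTheory.Site.shift_shift_comm`
-- (`Literature/MathematicalPhysics/QuantumFieldTheory/FlatLatticeGaugeFields.lean`, now imported);
-- its call sites use that declaration instead.

/-- Shifting the updated coordinate: `(x|_{κ := t}) + ê_κ = x|_{κ := t + 1}`. [folklore] -/
theorem shift_update_self (x : Site d L) (κ : Fin d) (t : ZMod L) :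
    Site.shift (Function.update x κ t) κ = Function.update x κ (t + 1) := by
  ext j
  by_cases h : j = κ
  · subst h; simp [Site.shift]
  · simp [Site.shift, h]

/-- Updating the shifted coordinate forgets the shift. [folklore] -/
theorem update_shift_self (x : Site d L) (κ : Fin d) (t : ZMod L) :
    Function.update (x.shift κ) κ t = Function.update x κ t := by
  ext j
  by_cases h : j = κ
  · subst h; simp
  · simp [Site.shift, h]

/-- Updates and shifts in different directions commute. [folklore] -/
theorem update_shift_of_ne (x : Site d L) {κ ν : Fin d} (h : ν ≠ κ) (t : ZMod L) :
    Function.update (x.shift ν) κ t = Site.shift (Function.update x κ t) ν := by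
  ext j
  by_cases hj : j = κ
  · subst hj; simp [Site.shift, h.symm]
  · by_cases hν : j = ν
    · subst hν; simp [Site.shift, hj]
    · simp [Site.shift, hj, hν]

/-- Updating a coordinate to its own value. [folklore] -/
theorem update_val_self [NeZero L] (x : Site d L) (κ : Fin d) :
    Function.update x κ (((x κ).val : ℕ) : ZMod L) = x := by
  rw [ZMod.natCast_zmod_val, Function.update_eq_self]

/-! ## §2. Line sums and partial sums along a coordinate direction -/

/-- A shift-invariant function on the torus is constant. [folklore] -/
theorem eq_of_forall_shift [NeZero L] {B : Type*} (f : Site d L → B) (h : ∀ x ρ, f (x.shift ρ) = f x)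
    (x y : Site d L) : f x = f y := by
  have hnat : ∀ (ρ : Fin d) (n : ℕ) (z : Site d L), f (z + Pi.single ρ (n : ZMod L)) = f z := by
    intro ρ n
    induction n with
    | zero => intro z; simp
    | succ n ih =>
      intro z
      have : z + Pi.single ρ ((n + 1 : ℕ) : ZMod L) = Site.shift (z + Pi.single ρ (n : ZMod L)) ρ := by
        rw [Site.shift, Nat.cast_succ, Pi.single_add, add_assoc]
      rw [this, h, ih]
  have hxy : x = y + ∑ ρ : Fin d, Pi.single ρ ((x - y) ρ) := by
    rw [Finset.univ_sum_single]; abel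
  suffices hS : ∀ (S : Finset (Fin d)) (z : Site d L),
      f (z + ∑ ρ ∈ S, Pi.single ρ ((x - y) ρ)) = f z by
    rw [hxy]; exact hS Finset.univ y
  intro S
  induction S using Finset.induction_on with
  | empty => intro z; simp
  | insert a S ha ih =>
    intro z
    rw [Finset.sum_insert ha, ← add_assoc, ih, ← ZMod.natCast_zmod_val ((x - y) a), hnat]


variable [NeZero L]

/-- The sum of `f` over the `κ`-circle through `x`. [folklore] -/
def lineSum (κ : Fin d) (f : Site d L → A) (x : Site d L) : A :=
  ∑ t : ZMod L, f (Function.update x κ t)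

/-- The partial sum of `f` along the `κ`-line through `x`, from coordinate `0` up to (excluding)
`x_κ`. [folklore] -/
def pSum (κ : Fin d) (f : Site d L → A) (x : Site d L) : A :=
  ∑ i ∈ range (x κ).val, f (Function.update x κ (i : ZMod L))

/-- Line sums do not see the `κ`-coordinate of the base point (update form). [folklore] -/
theorem lineSum_update_self (κ : Fin d) (f : Site d L → A) (x : Site d L) (s : ZMod L) :
    lineSum κ f (Function.update x κ s) = lineSum κ f x := by
  simp only [lineSum, Function.update_idem]

/-- Line sums do not see the `κ`-coordinate of the base point (shift form). [folklore] -/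
theorem lineSum_shift_self (κ : Fin d) (f : Site d L → A) (x : Site d L) :
    lineSum κ f (x.shift κ) = lineSum κ f x := by
  simp only [lineSum, update_shift_self]

/-- Line sums commute with transverse shifts. [folklore] -/
theorem lineSum_shift_of_ne {κ ν : Fin d} (h : ν ≠ κ) (f : Site d L → A) (x : Site d L) :
    lineSum κ f (x.shift ν) = lineSum κ (fun y => f (y.shift ν)) x := by
  simp only [lineSum, update_shift_of_ne x h]

/-- Line sums are additive. [folklore] -/
theorem lineSum_sub (κ : Fin d) (f g : Site d L → A) (x : Site d L) :
    lineSum κ (fun y => f y - g y) x = lineSum κ f x - lineSum κ g x := by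
  simp only [lineSum, Finset.sum_sub_distrib]

/-- Line sums are additive (sum form). [folklore] -/
theorem lineSum_add (κ : Fin d) (f g : Site d L → A) (x : Site d L) :
    lineSum κ (fun y => f y + g y) x = lineSum κ f x + lineSum κ g x := by
  simp only [lineSum, Finset.sum_add_distrib]

/-- The line sum of zero. [folklore] -/
theorem lineSum_zero_fun (κ : Fin d) (x : Site d L) : lineSum κ (fun _ => (0 : A)) x = 0 := by
  simp [lineSum]

/-- Line sums commute with negation. [folklore] -/
theorem lineSum_neg (κ : Fin d) (f : Site d L → A) (x : Site d L) :
    lineSum κ (fun y => -f y) x = -lineSum κ f x := by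
  simp only [lineSum, Finset.sum_neg_distrib]

/-- A discrete derivative along the line sums to zero around the circle. [folklore] -/
theorem lineSum_shift_sub_self (κ : Fin d) (g : Site d L → A) (x : Site d L) :
    lineSum κ (fun y => g (y.shift κ) - g y) x = 0 := by
  simp only [lineSum, shift_update_self, Finset.sum_sub_distrib]
  rw [sub_eq_zero]
  exact Fintype.sum_equiv (Equiv.addRight 1) _ _ fun t => rfl

omit [NeZero L] in
/-- Partial sums commute with transverse shifts. [folklore] -/
theorem pSum_shift_of_ne {κ ν : Fin d} (h : ν ≠ κ) (f : Site d L → A) (x : Site d L) :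
    pSum κ f (x.shift ν) = pSum κ (fun y => f (y.shift ν)) x := by
  simp only [pSum, update_shift_of_ne x h, shift_apply_of_ne x h.symm]

omit [NeZero L] in
/-- Partial sums are additive. [folklore] -/
theorem pSum_sub (κ : Fin d) (f g : Site d L → A) (x : Site d L) :
    pSum κ (fun y => f y - g y) x = pSum κ f x - pSum κ g x := by
  simp only [pSum, Finset.sum_sub_distrib]

omit [NeZero L] in
/-- The partial sum of zero. [folklore] -/
theorem pSum_zero_fun (κ : Fin d) (x : Site d L) : pSum κ (fun _ => (0 : A)) x = 0 := by
  simp [pSum]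

/-- **The partial sum is a primitive along the line**, up to the line sum dumped on the last site:
`(pSum f)(x + ê_κ) − (pSum f)(x) = f(x) − [x_κ = L−1]·(lineSum f)(x)`. [folklore] -/
theorem pSum_shift_self_sub (κ : Fin d) (f : Site d L → A) (x : Site d L) :
    pSum κ f (x.shift κ) - pSum κ f x =
      f x - if (x κ).val + 1 = L then lineSum κ f x else 0 := by
  simp only [pSum, update_shift_self, shift_apply_self]
  have hlt : (x κ).val < L := ZMod.val_lt _
  by_cases hx : (x κ).val + 1 = L
  · rw [if_pos hx, val_add_one_eq_mod, hx, Nat.mod_self, Finset.sum_range_zero]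
    have htot : ∑ i ∈ range ((x κ).val + 1), f (Function.update x κ (i : ZMod L)) = lineSum κ f x := by
      rw [hx, lineSum]
      exact sum_range_cast_eq (fun t => f (Function.update x κ t))
    rw [Finset.sum_range_succ, update_val_self] at htot
    rw [← htot]; abel
  · have hx' : (x κ).val + 1 < L := by omega
    rw [if_neg hx, val_add_one_eq_mod, Nat.mod_eq_of_lt hx', Finset.sum_range_succ, update_val_self]
    abel

/-- **Telescoping of partial sums**: the partial sum of a discrete `κ`-derivative is the difference
of the end values. [folklore] -/
theorem pSum_shift_sub (κ : Fin d) (g : Site d L → A) (x : Site d L) :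
    pSum κ (fun y => g (y.shift κ) - g y) x = g x - g (Function.update x κ 0) := by
  simp only [pSum, shift_update_self]
  have h := Finset.sum_range_sub (fun i : ℕ => g (Function.update x κ (i : ZMod L))) (x κ).val
  simp only [Nat.cast_succ, Nat.cast_zero] at h
  rw [h, update_val_self]

/-! ## §3. Degree one: closed 1-cochains with vanishing circle sums are gradients -/

/-- The lattice gradient of a `0`-cochain. [folklore] -/
def grad (φ : Site d L → A) (x : Site d L) (ν : Fin d) : A := φ (x.shift ν) - φ x

omit [NeZero L] in
/-- Gradients are closed `1`-cochains (`Δ_ν W_ρ = Δ_ρ W_ν`). [folklore] -/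
theorem grad_closed (φ : Site d L → A) (x : Site d L) (ν ρ : Fin d) :
    grad φ (x.shift ν) ρ - grad φ x ρ = grad φ (x.shift ρ) ν - grad φ x ν := by
  simp only [grad, Site.shift_shift_comm x ν ρ]
  abel

omit [NeZero L] in
/-- Closedness is preserved under subtraction. [folklore] -/
theorem sub_closed {W W' : Site d L → Fin d → A}
    (h : ∀ x ν ρ, W (x.shift ν) ρ - W x ρ = W (x.shift ρ) ν - W x ν)
    (h' : ∀ x ν ρ, W' (x.shift ν) ρ - W' x ρ = W' (x.shift ρ) ν - W' x ν) (x : Site d L) (ν ρ : Fin d) :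
    (W (x.shift ν) ρ - W' (x.shift ν) ρ) - (W x ρ - W' x ρ) =
      (W (x.shift ρ) ν - W' (x.shift ρ) ν) - (W x ν - W' x ν) := by
  have h1 := h x ν ρ
  have h2 := h' x ν ρ
  rw [sub_eq_iff_eq_add] at h1 h2
  rw [h1, h2]; abel

/-- Gradients have vanishing circle sums. [folklore] -/
theorem lineSum_grad (ν : Fin d) (φ : Site d L → A) (x : Site d L) :
    lineSum ν (fun y => grad φ y ν) x = 0 :=
  lineSum_shift_sub_self ν φ x

/-- **Killing one direction.**  For a closed `1`-cochain with vanishing circle sums, subtracting the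
gradient of the partial-sum primitive along `κ` kills the `κ`-component and keeps killed
components killed. [folklore] -/
theorem kill_one (κ : Fin d) (W : Site d L → Fin d → A)
    (hc : ∀ x ν ρ, W (x.shift ν) ρ - W x ρ = W (x.shift ρ) ν - W x ν)
    (hl : ∀ x ν, lineSum ν (fun y => W y ν) x = 0) :
    ∃ ψ : Site d L → A, (∀ x, W x κ - grad ψ x κ = 0) ∧
      ∀ μ, (∀ x, W x μ = 0) → ∀ x, W x μ - grad ψ x μ = 0 := by
  refine ⟨pSum κ (fun y => W y κ), fun x => ?_, fun μ hμ x => ?_⟩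
  · rw [grad, pSum_shift_self_sub, hl, ite_self, sub_zero, sub_self]
  · by_cases hμκ : μ = κ
    · subst hμκ
      rw [grad, pSum_shift_self_sub, hl, ite_self, sub_zero, sub_self]
    · rw [grad, pSum_shift_of_ne hμκ, ← pSum_sub]
      have hclosed : ∀ y, W (y.shift μ) κ - W y κ = W (y.shift κ) μ - W y μ := fun y => hc y μ κ
      simp only [hclosed]
      rw [pSum_shift_sub κ (fun y => W y μ) x]; simp [hμ]

/-- The iteration behind the degree-one lemma: if all components of index `≥ n` vanish, a
primitive exists. [folklore] -/
theorem exists_grad_eq_aux :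
    ∀ n : ℕ, ∀ W : Site d L → Fin d → A,
      (∀ x ν ρ, W (x.shift ν) ρ - W x ρ = W (x.shift ρ) ν - W x ν) →
      (∀ x ν, lineSum ν (fun y => W y ν) x = 0) → (∀ x (ν : Fin d), n ≤ ν.val → W x ν = 0) →
      ∃ φ : Site d L → A, ∀ x ν, grad φ x ν = W x ν := by
  intro n
  induction n with
  | zero =>
    intro W _ _ hk
    exact ⟨fun _ => 0, fun x ν => by rw [hk x ν (Nat.zero_le _)]; simp [grad]⟩
  | succ n ih =>
    intro W hc hl hk
    by_cases hn : n < d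
    · obtain ⟨ψ, hψκ, hψμ⟩ := kill_one ⟨n, hn⟩ W hc hl
      obtain ⟨φ, hφ⟩ := ih (fun x ν => W x ν - grad ψ x ν) (sub_closed hc (grad_closed ψ))
        (fun x ν => by rw [lineSum_sub, hl, lineSum_grad, sub_zero])
        (fun x ν hν => by
          by_cases hνn : ν.val = n
          · have : ν = ⟨n, hn⟩ := Fin.ext hνn
            subst this; exact hψκ x
          · exact hψμ ν (fun y => hk y ν (by omega)) x)
      exact ⟨fun x => φ x + ψ x, fun x ν => by
        have h := hφ x ν
        simp only [grad] at h ⊢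
        rw [← sub_eq_zero]; rw [← sub_eq_zero] at h; rw [← h]; abel⟩
    · exact ih W hc hl (fun x ν hν => absurd (lt_of_lt_of_le (by omega) (le_refl _)) (by
        have := ν.isLt; omega))

/-- **Integer Poincaré lemma on the discrete torus, degree one.**  A closed `1`-cochain on
`(ℤ/L)^d` with values in an abelian group all of whose circle sums vanish is the gradient of a
`0`-cochain. [folklore] -/
theorem exists_grad_eq (W : Site d L → Fin d → A)
    (hc : ∀ x ν ρ, W (x.shift ν) ρ - W x ρ = W (x.shift ρ) ν - W x ν)
    (hl : ∀ x ν, lineSum ν (fun y => W y ν) x = 0) :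
    ∃ φ : Site d L → A, ∀ x ν, grad φ x ν = W x ν :=
  exists_grad_eq_aux d W hc hl (fun _ ν hν => absurd ν.isLt (not_lt.mpr hν))

/-! ## §4. Line sums in the `x + t κ̂` parametrisation -/

omit [NeZero L] in
/-- A coordinate update is a translate by a coordinate vector. [folklore] -/
theorem update_eq_add_single (x : Site d L) (κ : Fin d) (t : ZMod L) :
    Function.update x κ (t + x κ) = x + Pi.single κ t := by
  ext j
  by_cases h : j = κ
  · subst h; simp [add_comm]
  · simp [h]

/-- Line sums as sums over `x + t κ̂`. [folklore] -/
theorem lineSum_eq_sum_add_single (κ : Fin d) (f : Site d L → A) (x : Site d L) :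
    lineSum κ f x = ∑ t : ZMod L, f (x + Pi.single κ t) := by
  rw [lineSum]
  exact (Fintype.sum_equiv (Equiv.addRight (x κ)) (fun t => f (x + Pi.single κ t))
    (fun t => f (Function.update x κ t)) fun t => by
      rw [Equiv.coe_addRight, update_eq_add_single]).symm

end Summit.Ventures.LatticeQCDFlow.Theory2.Lattice.Flux.TorusCochain

end
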